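import Summits.KontsevichZagierPeriods.KontsevichZagierPeriods.Theses.SpheresForWalls
import Summits.KontsevichZagierPeriods.KontsevichZagierPeriods.Theorems.InverseLandauTateLiftingUnitIntervalSpin

/-!
# `UnitIntervalSpin` (stmt-KontsevichZagierPeriods-16460, route SpheresForWalls) — proof

`[D̄ × (0,1), 1] − [ℝ², (1+|w|²)⁻²] ∈ KZ.relations`: every three-dimensional integral representation
with domain `{z₀² + z₁² ≤ 1, 0 < z₂ < 1}` and integrand `1` on it differs by relations of the
Kontsevich–Zagier calculus from every two-dimensional representation with domain `ℝ²` and integrand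
`((1 + (w₀² + w₁²))²)⁻¹` (value `π` on both sides; calibration 1 of the route). It is verbatim
`Summit.KontsevichZagierPeriods.InverseLandau.tateLifting_unitIntervalSpin`
(`Theorems/InverseLandauTateLiftingUnitIntervalSpin.lean`, stub of the line `Sketch` of the crux
`TateLifting`, stmt-KontsevichZagierPeriods-9129, lead c10): slab Newton–Leibniz move and null
boundary for `[D̄ × (0,1), 1] ≡ [D̄]`, and the area of the sphere inside the rules
(`tateLifting_sphereArea`) with integer scaling and torsion-freeness for `[ℝ², (1+|w|²)⁻²] ≡ [D̄]`.
-/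

namespace Summit.KontsevichZagierPeriods.SpheresForWalls

/-- **`UnitIntervalSpin`** (route SpheresForWalls, stmt-KontsevichZagierPeriods-16460): a
representation `[{z₀²+z₁² ≤ 1, 0 < z₂ < 1}, 1]` and a representation `[ℝ², ((1+(w₀²+w₁²))²)⁻¹]`
differ by an element of `KZ.relations`. Proof: `InverseLandau.tateLifting_unitIntervalSpin`.
[cite: KontsevichZagier2001, §1.2] -/
theorem unitIntervalSpin_proof :
    Summit.KontsevichZagierPeriods.KontsevichZagierPeriods.Theses.SpheresForWalls.UnitIntervalSpin :=
  Summit.KontsevichZagierPeriods.InverseLandau.tateLifting_unitIntervalSpin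

end Summit.KontsevichZagierPeriods.SpheresForWalls
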